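import Mathlib
import HarnessLib
import Summits.HubbardSuperconductivity.HubbardSuperconductivity.Theorems.KLProgrammeKLRegimeTwoPointAssemblyConservation
import Summits.HubbardSuperconductivity.HubbardSuperconductivity.Theorems.KLProgrammeKLRegimeWickOrderedStep

/-!
# Route `KLProgramme` — ENGINE child (E2-v9): CONSERVATION LAWS of the scale-`n` actions `𝒱_n` and `𝒲_n` in every degree
# (E2-WICK-ROADMAP §5 (iii-b); cell gate-hubbard-kl, seat p1 g8)

The model bubble reading at the pair labels (§5 (iii)) needs that the kernels of the scale-`n` action — plain `𝒱_n = klEffectiveAction … n`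
and Wick-smeared `𝒲_n = klWickAction … n = e^{Δ_{D_n}}𝒱_n` — conserve charge, Matsubara frequency, lattice momentum and spin in EVERY
degree `m`.  The two-point case for the fully integrated action is r2d-p2's `…TwoPointAssemblyConservation` (charge scalings
`ψ̂^±_{kσ} ↦ φ(k,σ)^{±1}ψ̂^±_{kσ}`, `GrassmannChargeScaling.kernel_eq_zero_of_invariant`); this file runs the same argument at scale `n`:
(§1) the CUTOFF covariances `C^K_{>Λ}`, `C^K_{≤Λ}`, slices are invariant under every non-zero weight (the cutoff factor is a function of the
two momenta only); (§2) hence `𝒱_n` (an `effAction` of `C^K_{>Λ_n}`) and `𝒲_n` (its `e^{Δ_{C^K_{≤Λ_n}}}`-image) are invariant under every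
vertex-compatible scaling (`map_scaling_klEffectiveAction`, `map_scaling_klWickAction`); (§3) the selection rule in every degree
(`kernel_klWickAction_eq_zero_of_weight_ne`, `…klEffectiveAction…`); (§4) the four laws as signed sums over the label string
(charge sign `±1` for `ψ̂^±`, written `(if (X i).2 = 0 then 1 else -1 : ℤ)`): total charge `Σ_i ± 1 = 0`, frequency `Σ_i ± n(ω_i) = 0`, momentum `Σ_i ± k⃗_i = 0` (in `(ℤ/L)²`), spin
`Σ_{i : σ_i = ↑} ± 1 = 0` — else the kernel VANISHES (`kernel_klWickAction_eq_zero_of_charge/_freq/_momentum/_spin`, and the same for `𝒱_n`).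
Proved; model bookkeeping; no analysis; nothing about the model's physics is asserted beyond these exact symmetries.
-/

noncomputable section

namespace Summit.HubbardSuperconductivity.HubbardSuperconductivity.Theorems.KLRegimeWick

set_option linter.dupNamespace false -- summit = problem name (single-conjunct summit), D-0017

open Literature.MathematicalPhysics.QuantumLattice GrassmannAlgebra Finset Matrix
open Literature.Probability.LatticeModels
open Summit.HubbardSuperconductivity.HubbardSuperconductivity.Theorems.TwoPointAssembly
open Summit.HubbardSuperconductivity.HubbardSuperconductivity.Theorems.KLProgrammeLegKernels
open Summit.HubbardSuperconductivity.HubbardSuperconductivity.Theorems.KLRegimeSplit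

variable {L M : ℕ} [NeZero L]

/-! ## §1 The cutoff covariances are invariant under every charge scaling -/

omit [NeZero L] in
/-- `C^K_{>Λ}` is invariant: the cutoff factor depends on the two momenta only. -/
theorem scalingWeight_covAboveCT_invariant (φ : FreqMomentum L M × Fin 2 → ℂ) (hφ : ∀ p, φ p ≠ 0) (β μ : ℝ) (K : TrigPolyC4v) (Λ : ℝ)
    (X Y : HubbardFieldIdx L M) :
    scalingWeight φ X * scalingWeight φ Y * hubbardCovAboveCT L M β μ 0 K Λ X Y = hubbardCovAboveCT L M β μ 0 K Λ X Y := by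
  simp only [hubbardCovAboveCT, Matrix.of_apply]
  rw [show ∀ (a b w c : ℂ), a * b * (w * c) = w * (a * b * c) from fun a b w c => by ring, scalingWeight_covariance_invariant φ hφ]

omit [NeZero L] in
/-- `C^K_{≤Λ} = C^K − C^K_{>Λ}` is invariant. -/
theorem scalingWeight_covBelowCT_invariant (φ : FreqMomentum L M × Fin 2 → ℂ) (hφ : ∀ p, φ p ≠ 0) (β μ : ℝ) (K : TrigPolyC4v) (Λ : ℝ)
    (X Y : HubbardFieldIdx L M) :
    scalingWeight φ X * scalingWeight φ Y * hubbardCovBelowCT L M β μ 0 K Λ X Y = hubbardCovBelowCT L M β μ 0 K Λ X Y := by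
  simp only [hubbardCovBelowCT, Matrix.sub_apply, mul_sub, scalingWeight_covariance_invariant φ hφ, scalingWeight_covAboveCT_invariant φ hφ]

omit [NeZero L] in
/-- The slices `C^K_{>Λ} − C^K_{>Λ′}` are invariant. -/
theorem scalingWeight_covSliceCT_invariant (φ : FreqMomentum L M × Fin 2 → ℂ) (hφ : ∀ p, φ p ≠ 0) (β μ : ℝ) (K : TrigPolyC4v) (Λ Λ' : ℝ)
    (X Y : HubbardFieldIdx L M) :
    scalingWeight φ X * scalingWeight φ Y * hubbardCovSliceCT L M β μ 0 K Λ Λ' X Y = hubbardCovSliceCT L M β μ 0 K Λ Λ' X Y := by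
  simp only [hubbardCovSliceCT, Matrix.sub_apply, mul_sub, scalingWeight_covAboveCT_invariant φ hφ]

/-! ## §2 Invariance of `𝒱_n` and `𝒲_n` under vertex-compatible scalings -/

/-- The scale-`Λ` countertermed effective action (seed `0`) is invariant under every non-zero vertex-compatible scaling. -/
theorem map_scaling_hubbardEffectiveActionCT (φ : FreqMomentum L M × Fin 2 → ℂ) (hφ : ∀ p, φ p ≠ 0)
    (hV : ∀ k₁ k₂ k₃ k₄ : FreqMomentum L M,
      matsubaraInt M k₁.1 + matsubaraInt M k₃.1 = matsubaraInt M k₂.1 + matsubaraInt M k₄.1 ∧ k₁.2 + k₃.2 = k₂.2 + k₄.2 →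
        φ (k₁, 0) * φ (k₃, 1) = φ (k₂, 0) * φ (k₄, 1))
    (β U μ : ℝ) (K : TrigPolyC4v) (Λ : ℝ) :
    ExteriorAlgebra.map (LinearMap.mulLeft ℂ (scalingWeight φ)) (hubbardEffectiveActionCT L M β U μ 0 K Λ) =
      hubbardEffectiveActionCT L M β U μ 0 K Λ := by
  rw [hubbardEffectiveActionCT_def]
  refine map_mulLeft_effAction_of_invariant ℂ (scalingWeightInv_mul φ hφ)
    (fun X Y => scalingWeight_covAboveCT_invariant φ hφ β μ K Λ X Y) ?_
  rw [hubbardInteractionCT, map_add, map_scaling_hubbardInteraction φ hφ hV, map_scaling_counterQuadratic φ hφ]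

/-- **`𝒱_n` is invariant** under every non-zero vertex-compatible scaling. -/
theorem map_scaling_klEffectiveAction [NeZero M] (φ : FreqMomentum L M × Fin 2 → ℂ) (hφ : ∀ p, φ p ≠ 0)
    (hV : ∀ k₁ k₂ k₃ k₄ : FreqMomentum L M,
      matsubaraInt M k₁.1 + matsubaraInt M k₃.1 = matsubaraInt M k₂.1 + matsubaraInt M k₄.1 ∧ k₁.2 + k₃.2 = k₂.2 + k₄.2 →
        φ (k₁, 0) * φ (k₃, 1) = φ (k₂, 0) * φ (k₄, 1))
    (β U μ : ℝ) (K : TrigPolyC4v) (e₀ : ℝ) (n : ℕ) :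
    ExteriorAlgebra.map (LinearMap.mulLeft ℂ (scalingWeight φ)) (klEffectiveAction L M β U μ K e₀ n) = klEffectiveAction L M β U μ K e₀ n :=
  map_scaling_hubbardEffectiveActionCT φ hφ hV β U μ K _

/-- A Gaussian convolution with an invariant covariance commutes with the scaling. -/
theorem map_scaling_gaussConv (φ : FreqMomentum L M × Fin 2 → ℂ) {D : Matrix (HubbardFieldIdx L M) (HubbardFieldIdx L M) ℂ}
    (hD : ∀ X Y, scalingWeight φ X * scalingWeight φ Y * D X Y = D X Y) (a : HubbardGrassmann L M) :
    ExteriorAlgebra.map (LinearMap.mulLeft ℂ (scalingWeight φ)) (gaussConv ℂ D a) =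
      gaussConv ℂ D (ExteriorAlgebra.map (LinearMap.mulLeft ℂ (scalingWeight φ)) a) := by
  have hD' : (Matrix.of fun X Y => scalingWeight φ X * scalingWeight φ Y * D X Y) = D := Matrix.ext fun X Y => hD X Y
  rw [gaussConv_map_mulLeft, hD']

/-- **`𝒲_n = e^{Δ_{D_n}}𝒱_n` is invariant** under every non-zero vertex-compatible scaling. -/
theorem map_scaling_klWickAction [NeZero M] (φ : FreqMomentum L M × Fin 2 → ℂ) (hφ : ∀ p, φ p ≠ 0)
    (hV : ∀ k₁ k₂ k₃ k₄ : FreqMomentum L M,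
      matsubaraInt M k₁.1 + matsubaraInt M k₃.1 = matsubaraInt M k₂.1 + matsubaraInt M k₄.1 ∧ k₁.2 + k₃.2 = k₂.2 + k₄.2 →
        φ (k₁, 0) * φ (k₃, 1) = φ (k₂, 0) * φ (k₄, 1))
    (β U μ : ℝ) (K : TrigPolyC4v) (n : ℕ) :
    ExteriorAlgebra.map (LinearMap.mulLeft ℂ (scalingWeight φ)) (klWickAction L M β U μ K n) = klWickAction L M β U μ K n := by
  have hD : ∀ X Y, scalingWeight φ X * scalingWeight φ Y * klSoftCov L M β μ K n X Y = klSoftCov L M β μ K n X Y :=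
    fun X Y => scalingWeight_covBelowCT_invariant φ hφ β μ K _ X Y
  rw [klWickAction, map_scaling_gaussConv φ hD, map_scaling_klEffectiveAction φ hφ hV]

/-! ## §3 The selection rule in every degree -/

/-- **Selection rule for `𝒲_n`**: under a non-zero vertex-compatible weight, the degree-`m` kernel vanishes on every label string of
total weight `≠ 1`. -/
theorem kernel_klWickAction_eq_zero_of_weight_ne [NeZero M] (φ : FreqMomentum L M × Fin 2 → ℂ) (hφ : ∀ p, φ p ≠ 0)
    (hV : ∀ k₁ k₂ k₃ k₄ : FreqMomentum L M,
      matsubaraInt M k₁.1 + matsubaraInt M k₃.1 = matsubaraInt M k₂.1 + matsubaraInt M k₄.1 ∧ k₁.2 + k₃.2 = k₂.2 + k₄.2 →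
        φ (k₁, 0) * φ (k₃, 1) = φ (k₂, 0) * φ (k₄, 1))
    (β U μ : ℝ) (K : TrigPolyC4v) (n : ℕ) {m : ℕ} {X : Fin m → HubbardFieldIdx L M} (hw : ∏ i, scalingWeight φ (X i) ≠ 1) :
    kernel ℂ (klWickAction L M β U μ K n) m X = 0 :=
  kernel_eq_zero_of_invariant ℂ (scalingWeight φ) (map_scaling_klWickAction φ hφ hV β U μ K n) hw

/-- **Selection rule for `𝒱_n`.** -/
theorem kernel_klEffectiveAction_eq_zero_of_weight_ne [NeZero M] (φ : FreqMomentum L M × Fin 2 → ℂ) (hφ : ∀ p, φ p ≠ 0)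
    (hV : ∀ k₁ k₂ k₃ k₄ : FreqMomentum L M,
      matsubaraInt M k₁.1 + matsubaraInt M k₃.1 = matsubaraInt M k₂.1 + matsubaraInt M k₄.1 ∧ k₁.2 + k₃.2 = k₂.2 + k₄.2 →
        φ (k₁, 0) * φ (k₃, 1) = φ (k₂, 0) * φ (k₄, 1))
    (β U μ : ℝ) (K : TrigPolyC4v) (e₀ : ℝ) (n : ℕ) {m : ℕ} {X : Fin m → HubbardFieldIdx L M} (hw : ∏ i, scalingWeight φ (X i) ≠ 1) :
    kernel ℂ (klEffectiveAction L M β U μ K e₀ n) m X = 0 :=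
  kernel_eq_zero_of_invariant ℂ (scalingWeight φ) (map_scaling_klEffectiveAction φ hφ hV β U μ K e₀ n) hw

/-! ## §4 The four conservation laws as signed sums -/

omit [NeZero L] in
/-- The weight of a label is `φ^{±1}`, the CHARGE SIGN `±1 = [ψ̂⁺] − [ψ̂⁻]` (charge index `0 ↦ ψ̂⁺`, `1 ↦ ψ̂⁻`); below the charge sign of
`Xᵢ` is written `(if (X i).2 = 0 then 1 else -1 : ℤ)`. -/
theorem scalingWeight_eq_zpow (φ : FreqMomentum L M × Fin 2 → ℂ) (X : HubbardFieldIdx L M) :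
    scalingWeight φ X = φ X.1 ^ (if X.2 = 0 then (1 : ℤ) else -1) := by
  unfold scalingWeight
  split_ifs <;> simp

omit [NeZero L] in
/-- Powers of `2` multiply: `∏_i 2^{e_i} = 2^{Σ_i e_i}`. -/
theorem prod_two_zpow {ι : Type*} (s : Finset ι) (e : ι → ℤ) : ∏ i ∈ s, (2 : ℂ) ^ e i = 2 ^ ∑ i ∈ s, e i := by
  classical
  induction s using Finset.induction_on with
  | empty => simp
  | insert a s ha ih => rw [Finset.prod_insert ha, Finset.sum_insert ha, ih, zpow_add₀ two_ne_zero]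

omit [NeZero L] in
/-- For a weight `φ = 2^{g}`: the total weight of a label string is `2^{Σ_i ±g(Xᵢ)}`. -/
theorem prod_scalingWeight_two_zpow (g : FreqMomentum L M × Fin 2 → ℤ) {m : ℕ} (X : Fin m → HubbardFieldIdx L M) :
    ∏ i, scalingWeight (fun p => (2 : ℂ) ^ g p) (X i) = 2 ^ ∑ i, (if (X i).2 = 0 then (1 : ℤ) else -1) * g (X i).1 := by
  rw [← prod_two_zpow]
  refine Finset.prod_congr rfl fun i _ => ?_
  rw [scalingWeight_eq_zpow, ← _root_.zpow_mul, mul_comm]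

omit [NeZero L] in
/-- A weight `2^{g}` is vertex-compatible when `g` is additive across the Hubbard vertex. -/
theorem twoPow_compatible (g : FreqMomentum L M × Fin 2 → ℤ)
    (hg : ∀ k₁ k₂ k₃ k₄ : FreqMomentum L M,
      matsubaraInt M k₁.1 + matsubaraInt M k₃.1 = matsubaraInt M k₂.1 + matsubaraInt M k₄.1 ∧ k₁.2 + k₃.2 = k₂.2 + k₄.2 →
        g (k₁, 0) + g (k₃, 1) = g (k₂, 0) + g (k₄, 1)) :
    ∀ k₁ k₂ k₃ k₄ : FreqMomentum L M,
      matsubaraInt M k₁.1 + matsubaraInt M k₃.1 = matsubaraInt M k₂.1 + matsubaraInt M k₄.1 ∧ k₁.2 + k₃.2 = k₂.2 + k₄.2 →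
        (fun p => (2 : ℂ) ^ g p) (k₁, 0) * (fun p => (2 : ℂ) ^ g p) (k₃, 1) =
          (fun p => (2 : ℂ) ^ g p) (k₂, 0) * (fun p => (2 : ℂ) ^ g p) (k₄, 1) := by
  intro k₁ k₂ k₃ k₄ h
  dsimp only
  rw [← zpow_add₀ two_ne_zero, ← zpow_add₀ two_ne_zero, hg k₁ k₂ k₃ k₄ h]

/-- **Selection rule for weights `2^{g}`**: if `Σ_i ±g(Xᵢ) ≠ 0` for a vertex-additive `g`, the kernel of `𝒲_n` vanishes at `X`. -/
theorem kernel_klWickAction_eq_zero_of_twoPow [NeZero M] (g : FreqMomentum L M × Fin 2 → ℤ)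
    (hg : ∀ k₁ k₂ k₃ k₄ : FreqMomentum L M,
      matsubaraInt M k₁.1 + matsubaraInt M k₃.1 = matsubaraInt M k₂.1 + matsubaraInt M k₄.1 ∧ k₁.2 + k₃.2 = k₂.2 + k₄.2 →
        g (k₁, 0) + g (k₃, 1) = g (k₂, 0) + g (k₄, 1))
    (β U μ : ℝ) (K : TrigPolyC4v) (n : ℕ) {m : ℕ} {X : Fin m → HubbardFieldIdx L M} (hX : ∑ i, (if (X i).2 = 0 then (1 : ℤ) else -1) * g (X i).1 ≠ 0) :
    kernel ℂ (klWickAction L M β U μ K n) m X = 0 := by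
  refine kernel_klWickAction_eq_zero_of_weight_ne (fun p => (2 : ℂ) ^ g p) (fun p => zpow_ne_zero _ two_ne_zero)
    (twoPow_compatible g hg) β U μ K n ?_
  rw [prod_scalingWeight_two_zpow]
  intro h
  exact hX (two_zpow_injective (h.trans (zpow_zero (2 : ℂ)).symm))

/-- **CHARGE conservation**: a kernel of `𝒲_n` with `Σ_i ±1 ≠ 0` (unequal numbers of `ψ̂⁺` and `ψ̂⁻`) vanishes. -/
theorem kernel_klWickAction_eq_zero_of_charge [NeZero M] (β U μ : ℝ) (K : TrigPolyC4v) (n : ℕ) {m : ℕ} {X : Fin m → HubbardFieldIdx L M}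
    (hX : ∑ i, (if (X i).2 = 0 then (1 : ℤ) else -1) ≠ 0) : kernel ℂ (klWickAction L M β U μ K n) m X = 0 :=
  kernel_klWickAction_eq_zero_of_twoPow (fun _ => 1) (fun _ _ _ _ _ => rfl) β U μ K n (by simpa using hX)

/-- **FREQUENCY conservation**: a kernel of `𝒲_n` with `Σ_i ±n(ωᵢ) ≠ 0` vanishes. -/
theorem kernel_klWickAction_eq_zero_of_freq [NeZero M] (β U μ : ℝ) (K : TrigPolyC4v) (n : ℕ) {m : ℕ} {X : Fin m → HubbardFieldIdx L M}
    (hX : ∑ i, (if (X i).2 = 0 then (1 : ℤ) else -1) * matsubaraInt M (X i).1.1.1 ≠ 0) : kernel ℂ (klWickAction L M β U μ K n) m X = 0 :=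
  kernel_klWickAction_eq_zero_of_twoPow (fun p => matsubaraInt M p.1.1) (fun _ _ _ _ h => h.1) β U μ K n hX

/-- **SPIN conservation** (given charge conservation, equivalently `S_z`): a kernel of `𝒲_n` with `Σ_{i : σᵢ = ↑} ±1 ≠ 0` vanishes. -/
theorem kernel_klWickAction_eq_zero_of_spin [NeZero M] (β U μ : ℝ) (K : TrigPolyC4v) (n : ℕ) {m : ℕ} {X : Fin m → HubbardFieldIdx L M}
    (hX : ∑ i, (if (X i).2 = 0 then (1 : ℤ) else -1) * (if (X i).1.2 = 0 then 1 else 0) ≠ 0) : kernel ℂ (klWickAction L M β U μ K n) m X = 0 :=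
  kernel_klWickAction_eq_zero_of_twoPow (fun p => if p.2 = 0 then 1 else 0) (fun _ _ _ _ _ => by simp) β U μ K n hX

omit [NeZero L] in
/-- An additive character turns sums into products. -/
theorem addChar_map_sum {A R : Type*} [AddCommGroup A] [CommRing R] (ψ : AddChar A R) {ι : Type*} (s : Finset ι) (a : ι → A) :
    ψ (∑ i ∈ s, a i) = ∏ i ∈ s, ψ (a i) := by
  classical
  induction s using Finset.induction_on with
  | empty => simp
  | insert j s hj ih => rw [Finset.sum_insert hj, Finset.prod_insert hj, AddChar.map_add_eq_mul, ih]

/-- **MOMENTUM conservation**, coordinate by coordinate: a kernel of `𝒲_n` with `Σ_i ±k⃗ᵢ(j) ≠ 0` in `ℤ/L` vanishes. -/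
theorem kernel_klWickAction_eq_zero_of_momentum [NeZero M] (β U μ : ℝ) (K : TrigPolyC4v) (n : ℕ) {m : ℕ} {X : Fin m → HubbardFieldIdx L M}
    (j : Fin 2) (hX : ∑ i, (if (X i).2 = 0 then (1 : ℤ) else -1) • (X i).1.1.2 j ≠ 0) : kernel ℂ (klWickAction L M β U μ K n) m X = 0 := by
  refine kernel_klWickAction_eq_zero_of_weight_ne (fun p => (ZMod.stdAddChar (p.1.2 j) : ℂ)) (fun p => stdAddChar_ne_zero _)
    (fun k₁ k₂ k₃ k₄ h => ?_) β U μ K n ?_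
  · rw [← AddChar.map_add_eq_mul, ← AddChar.map_add_eq_mul, ← Pi.add_apply k₁.2, ← Pi.add_apply k₂.2, h.2]
  · have hw : ∏ i, scalingWeight (fun p => (ZMod.stdAddChar (p.1.2 j) : ℂ)) (X i) =
        ZMod.stdAddChar (∑ i, (if (X i).2 = 0 then (1 : ℤ) else -1) • (X i).1.1.2 j) := by
      rw [addChar_map_sum]
      refine Finset.prod_congr rfl fun i _ => ?_
      rw [scalingWeight_eq_zpow, AddChar.map_zsmul_eq_zpow]
    rw [hw]
    intro h
    apply hX
    exact ZMod.injective_stdAddChar (h.trans (AddChar.map_zero_eq_one _).symm)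

end Summit.HubbardSuperconductivity.HubbardSuperconductivity.Theorems.KLRegimeWick

end
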